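import Summits.CriticalPhenomena.CardyFormulaZ2.Theorems.CardyMagicRigidityMarkovCascadeDefs
import Summits.CriticalPhenomena.CardyFormulaZ2.Theorems.CardyMagicRigidityNestingRigidityOneGenerationZ2Interiors
import HarnessLib

/-!
# Outside locality of the loop representation of `ℤ²`

Crux `Summit.CriticalPhenomena.CardyFormulaZ2.Theses.CardyMagicRigidity.NestingRigidity`
(stmt-CriticalPhenomena-4835), line `markov-cascade-one-generation`, registered helper
`outsideLoopsZ2_eq_of_inter_eq` (wave 2, toward `stub_deAveraging` / `stub_cascadeReconstruction`):
the mirror image of the inside locality `insideLoopsZ2_subset_of_inter_eq` of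
`…OneGenerationZ2.lean`.

**Statement.** For `δ > 0`, two configurations `ω, ω' ∈ I_γ` (`γ` is an interface loop of both)
that agree on the edges strictly outside `γ` (`ω ∩ outsideEdges γ = ω' ∩ outsideEdges γ`) have the
same typed loops NOT inside `γ`:
`{u ∈ (bondLoopConfig δ 0 ω).F i | ¬ int u ⊆ int γ} = {u ∈ (bondLoopConfig δ 0 ω').F i | ¬ int u ⊆ int γ}`
(winding interiors `int u = {z | u.wind z ≠ 0}` at mesh `δ`).

**Proof** (Camia–Newman CMP 268 §2, locality of the loop representation).  Let
`u = [loopCurve δ 0 γ']` with `IsInterfaceLoop ω γ'` and `¬ int γ' ⊆ int γ`.  Every entry `e` of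
`γ'` is an entry of `γ` or an edge strictly outside `γ` (`mem_outsideEdges_of_mem_of_not_subset`):
if `e ∉ γ`, write `e = cSrc p` for a dart `p` of `γ'` with an interior cell
(`exists_eq_cSrc_of_mem`); the midpoint `m` of `e` is off the trace of `γ`, so `wind_γ (m)` is the
winding number of `γ` at both cells of `p` (`wind_medialPoint_cSrc_eq`).  If `wind_γ (m) ≠ 0`, the
interior trichotomy (`interfaceLoop_interiors_nested_or_disjoint`) leaves two cases: `int γ ⊆ int γ'`
puts `m`, a point of the trace of `γ'` (`medialPoint_mem_range_loopCurve`, winding number `0`),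
inside `γ'` — absurd; `int γ ∩ int γ' = ∅` is contradicted by the interior cell of `p`, which is
inside both.  Hence `wind_γ (m) = 0`, i.e. `e ∈ outsideEdges γ`, where `ω` and `ω'` agree; on the
entries of `γ` they agree too, because the turning rule of `γ` at `e` pins the state of `e`
(`mem_iff_of_isMedialTurn`: the successor corner `nextCorner ω p` follows `e` iff `e` is open).
By the cylinder property (`isInterfaceLoop_of_forall_mem_iff`) `γ'` is an interface loop of `ω'`,
of the same type and with the same drawn loop; symmetry gives equality.
-/

noncomputable section

open Set Function

namespace Summit.CriticalPhenomena.CardyFormulaZ2.Cruxes.NestingRigidity.MarkovCascadeOneGeneration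

open Literature.Probability.RandomPlanarGeometry Literature.Probability.Percolation
  Literature.Probability.LatticeModels

variable {ω ω' : BondConfig (Site 2)} {γ γ' : List MedialVertex} {δ : ℝ}

/-! ## The states of the entries of `γ` are pinned by `I_γ` -/

/-- **The turning rule at `e₁` pins the state of `e₁`**: if `(e₀, e₁, e₂)` is a turning triple of
both `ω` and `ω'`, then `e₁ ∈ ω ↔ e₁ ∈ ω'` (the corner of `(e₁, e₂)` is the successor
`nextCorner · p` of the corner `p` of `(e₀, e₁)`, which follows `e₁` iff `e₁` is open and turns
around the vertex otherwise — two different corners). -/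
theorem mem_iff_of_isMedialTurn {e₀ e₁ e₂ : MedialVertex} (h : IsMedialTurn ω e₀ e₁ e₂)
    (h' : IsMedialTurn ω' e₀ e₁ e₂) : e₁ ∈ ω ↔ e₁ ∈ ω' := by
  obtain ⟨⟨p, hps, hpt⟩, ⟨q, hqs, hqt⟩⟩ := h.exists_corners
  have key : nextCorner ω p = nextCorner ω' p :=
    (h.corner_eq_nextCorner hps hpt hqs hqt).symm.trans (h'.corner_eq_nextCorner hps hpt hqs hqt)
  rw [← hpt]
  by_contra hne
  rcases em (cTgt p ∈ ω) with hω | hω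
  · have hω' : cTgt p ∉ ω' := fun h'' ↦ hne ⟨fun _ ↦ h'', fun _ ↦ hω⟩
    rw [nextCorner_of_mem hω, nextCorner_of_not_mem hω', Prod.mk.injEq] at key
    exact absurd key.2 (by simp)
  · have hω' : cTgt p ∈ ω' := by
      by_contra h''
      exact hne ⟨fun h₁ ↦ absurd h₁ hω, fun h₁ ↦ absurd h₁ h''⟩
    rw [nextCorner_of_not_mem hω, nextCorner_of_mem hω', Prod.mk.injEq] at key
    exact absurd key.2 (by simp)

/-- **`I_γ` pins the states of the entries of `γ`**: two configurations both having `γ` as an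
interface loop agree on every entry of `γ`. -/
theorem mem_iff_of_isInterfaceLoop (h : IsInterfaceLoop ω γ) (h' : IsInterfaceLoop ω' γ)
    {e : MedialVertex} (he : e ∈ γ) : e ∈ ω ↔ e ∈ ω' := by
  obtain ⟨j, hj, rfl⟩ := List.getElem_of_mem he
  have ht := h.turn_mod (j + γ.length - 1)
  have ht' := h'.turn_mod (j + γ.length - 1)
  have hidx : (j + γ.length - 1 + 1) % γ.length = j := by
    rw [show j + γ.length - 1 + 1 = j + γ.length by omega, Nat.add_mod_right, Nat.mod_eq_of_lt hj]
  have key := mem_iff_of_isMedialTurn ht ht'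
  rw [IsInterfaceLoop.getElem_idx_congr hidx] at key
  exact key

/-! ## Entries of a loop not inside `γ` -/

/-- **An entry of an interface loop `γ'` of `ω ∈ I_γ` NOT inside `γ` is an entry of `γ` or an
edge strictly outside `γ`** (mesh `1`). -/
theorem mem_outsideEdges_of_mem_of_not_subset (h : IsInterfaceLoop ω γ) (h' : IsInterfaceLoop ω γ')
    (hnot : ¬ {z | (loopCurve 1 0 γ').wind z ≠ 0} ⊆ {z | (loopCurve 1 0 γ).wind z ≠ 0})
    {e : MedialVertex} (he : e ∈ γ') (heγ : e ∉ γ) : e ∈ outsideEdges γ := by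
  refine ⟨?_, heγ⟩
  obtain ⟨p, rfl, hcell⟩ := exists_eq_cSrc_of_mem h' he
  obtain ⟨ev, ef⟩ := wind_medialPoint_cSrc_eq h heγ
  by_contra hm
  rcases interfaceLoop_interiors_nested_or_disjoint ω γ' γ h' h with hsub | hsub | hdis
  · exact hnot hsub
  · -- the midpoint is inside `γ`, hence inside `γ'`, but it lies on the trace of `γ'`
    exact hsub hm ((loopCurve 1 0 γ').wind_of_mem_range (medialPoint_mem_range_loopCurve γ' he))
  · -- the interior cell of the dart `p` of `γ'` is inside `γ` too
    rcases hcell with hv | hf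
    · exact disjoint_left.1 hdis hv fun h0 ↦ hm (ev.trans h0)
    · exact disjoint_left.1 hdis hf fun h0 ↦ hm (ef.trans h0)

/-- **Outside locality, one configuration to the other.** If `ω, ω' ∈ I_γ` agree on the edges
strictly outside `γ`, every interface loop of `ω` not inside `γ` (mesh `δ ≠ 0`) is an interface
loop of `ω'`. -/
theorem isInterfaceLoop_of_not_subset_of_inter_eq (hδ : δ ≠ 0) (h : IsInterfaceLoop ω γ)
    (hγ : IsInterfaceLoop ω' γ) (hωω' : ω ∩ outsideEdges γ = ω' ∩ outsideEdges γ)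
    (h' : IsInterfaceLoop ω γ')
    (hnot : ¬ {z | (loopCurve δ 0 γ').wind z ≠ 0} ⊆ {z | (loopCurve δ 0 γ).wind z ≠ 0}) :
    IsInterfaceLoop ω' γ' := by
  have hnot1 : ¬ {z | (loopCurve 1 0 γ').wind z ≠ 0} ⊆ {z | (loopCurve 1 0 γ).wind z ≠ 0} := by
    intro hsub
    refine hnot ?_
    rw [setOf_wind_loopCurve_mesh hδ γ', setOf_wind_loopCurve_mesh hδ γ]
    exact preimage_mono hsub
  refine isInterfaceLoop_of_forall_mem_iff (fun e he ↦ ?_) h'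
  by_cases heγ : e ∈ γ
  · exact mem_iff_of_isInterfaceLoop h hγ heγ
  · have hout : e ∈ outsideEdges γ := mem_outsideEdges_of_mem_of_not_subset h h' hnot1 he heγ
    have key := congrArg (e ∈ ·) hωω'
    simp only [mem_inter_iff, hout, and_true, eq_iff_iff] at key
    exact key

/-- Outside locality, inclusion form. -/
theorem outsideLoopsZ2_subset_of_inter_eq (hδ : δ ≠ 0) (h : IsInterfaceLoop ω γ)
    (hγ : IsInterfaceLoop ω' γ) (hωω' : ω ∩ outsideEdges γ = ω' ∩ outsideEdges γ) (i : Fin 2) :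
    {u ∈ (bondLoopConfig δ 0 ω).F i |
        ¬ ({z | u.wind z ≠ 0} ⊆ {z | (loopCurve δ 0 γ).wind z ≠ 0})} ⊆
      {u ∈ (bondLoopConfig δ 0 ω').F i |
        ¬ ({z | u.wind z ≠ 0} ⊆ {z | (loopCurve δ 0 γ).wind z ≠ 0})} := by
  rintro u ⟨hu, hnot⟩
  refine ⟨?_, hnot⟩
  obtain ⟨γ', h', ht, rfl⟩ := hu
  exact ⟨γ', isInterfaceLoop_of_not_subset_of_inter_eq hδ h hγ hωω' h' hnot, ht, rfl⟩

/-- **OUTSIDE LOCALITY (registered helper `outsideLoopsZ2_eq_of_inter_eq`).** On `I_γ` the typed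
loops of `δℤ²` NOT inside `γ` depend on `ω` only through its restriction to the edges strictly
outside `γ`: for `δ > 0` and `ω, ω' ∈ I_γ` with `ω ∩ outsideEdges γ = ω' ∩ outsideEdges γ`, the
loops of type `i` of `ω` and of `ω'` whose winding interior is not contained in that of the drawn
circuit `loopCurve δ 0 γ` coincide. -/
theorem outsideLoopsZ2_eq_of_inter_eq : ∀ (δ : ℝ) (γ : List MedialVertex) (ω ω' : BondConfig (Site 2)) (i : Fin 2), 0 < δ → IsInterfaceLoop ω γ → IsInterfaceLoop ω' γ → ω ∩ outsideEdges γ = ω' ∩ outsideEdges γ → {u ∈ (bondLoopConfig δ 0 ω).F i | ¬ ({z | u.wind z ≠ 0} ⊆ {z | (loopCurve δ 0 γ).wind z ≠ 0})} = {u ∈ (bondLoopConfig δ 0 ω').F i | ¬ ({z | u.wind z ≠ 0} ⊆ {z | (loopCurve δ 0 γ).wind z ≠ 0})} := by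
  intro δ γ ω ω' i hδ h h' hωω'
  exact (outsideLoopsZ2_subset_of_inter_eq hδ.ne' h h' hωω' i).antisymm
    (outsideLoopsZ2_subset_of_inter_eq hδ.ne' h' h hωω'.symm i)

end Summit.CriticalPhenomena.CardyFormulaZ2.Cruxes.NestingRigidity.MarkovCascadeOneGeneration

end
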